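import Mathlib
import HarnessLib
import Summits.HubbardSuperconductivity.HubbardSuperconductivity.Theorems.KLProgrammeKLRegimeSplitPredicatesV2
import Literature.MathematicalPhysics.QuantumLattice.GrassmannEffectiveActionTruncation

/-!
# Route `KLProgramme` — crux K3, gen-4 ENGINE child `KLRegimeEngineV12` (stmt-HubbardSuperconductivity-19855), stub
# `stub_engine_step_values`, conjunct (E2-v8): the WICK-ORDERED one-step structure of the scale-`n` action — the soft
# Gaussian smearing `𝒲_n = e^{Δ_{D_n}} 𝒱_n` moves ONLY by the nonlinear (order `≥ 2`) part of the step (no self-contraction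
# term), and its second-order part is a DIFFERENCE OF WICK STAR PRODUCTS (cell gate-hubbard-kl, seat p1 = C1 BetaSplit lead
# lineage, g8)

WHY (HOME/p1/E2-STRUCTURE-NOTE.md, this seat).  In the plain Wilsonian scheme of the carrier D1 (`klEffectiveAction … n =
effAction (C^K_{>Λ_n}) V_K`; one step `𝒱_n = effAction g_n 𝒱_{n-1}`, `g_n = C^K_{(Λ_n, Λ_{n-1}]}`), the FIRST-order term
`e^{Δ_{g_n}} 𝒱_{n-1}` of the cumulant expansion contracts the SIX-leg kernel `W₆^{(n-1)} ⊇ 𝒞·C^K_{>Λ_{n-1}}·𝒞` with one slice line: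
these are the particle–particle rungs pairing a slice-`n` line with a HARDER partner — for Salmhofer's cutoff `χ₂` and `γ = 4` an
`n`-INDEPENDENT fraction `0.0839` of the full per-scale rung mass `2∫w_n a_{n-1} dt/t = 0.2327` vs `ln 16 = 2.7726` (E2-STRUCTURE-NOTE
§2, in-seat quadrature), so the history's SIZES of `W₆` (`KernelNormsV4`, no structure) cannot place them within the `2^{-n}` budget of
(E2-v8).  Smearing the scale-`n` action by the SOFT covariance `D_n = C^K_{≤Λ_n}` (Wick ordering w.r.t. the fields not yet
integrated; Salmhofer 1998 §3, Feldman–Knörrer–Trubowitz's `Ω_C`) removes every single-vertex self-contraction from the step: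

* §1 the carriers: `klHardCov n = C^K_{>Λ_n}`, `klSoftCov n = C^K_{≤Λ_n}`, `klSliceCov n = C^K_{(Λ_n, Λ_{n-1}]}`, the Wick-smeared
  action `klWickAction n = e^{Δ_{D_n}} 𝒱_n` and its pair amplitude `klWickPairAmplitude` (same label tuple as `klPairAmplitude`);
  bookkeeping `klHardCov (n+1) = klSliceCov (n+1) + klHardCov n`, `klSoftCov n = klSoftCov (n+1) + klSliceCov (n+1)`;
* §2 generic algebra on a finite Grassmann algebra: `gaussConv D (effAction C V) - gaussConv (D + C) V =
  gaussConv D (effAction C V - gaussConv C V)` (**the smeared action moves only by the nonlinear part**), the Wick star product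
  `wickStar C a b = e^{Δ_C}((e^{-Δ_C} a)(e^{-Δ_C} b))` and the rewriting of the second cumulant
  `e^{Δ_D}(e^{Δ_C}(V V) - (e^{Δ_C}V)(e^{Δ_C}V)) = wickStar (D + C) W W - wickStar D W W` for `W = e^{Δ_{D+C}} V`;
* §3 the model instances: the one-step semigroup `klEffectiveAction (n+1) = effAction (klSliceCov (n+1)) (klEffectiveAction n)`
  (given `Z ≠ 0`), **`klw_wickAction_succ`** (`𝒲_{n+1} - 𝒲_n = e^{Δ_{D_{n+1}}}(effAction g 𝒱_n - e^{Δ_g} 𝒱_n)`),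
  **`klw_wickAction_succ_secondOrder`** (`𝒲_{n+1} = 𝒲_n - ½(𝒲_n ⋆_{D_n} 𝒲_n - 𝒲_n ⋆_{D_{n+1}} 𝒲_n) + e^{Δ_{D_{n+1}}} R₃` with
  `R₃ = effAction g 𝒱_n - e^{Δ_g}𝒱_n + ½(e^{Δ_g}(𝒱_n²) - (e^{Δ_g}𝒱_n)²)` — the remainder whose kernels
  `GrassmannEffectiveActionTruncation.sum_norm_kernel_effAction_sub_secondOrder_le` bounds at third order), and the pair-amplitude
  readings `klw_wickPairAmplitude_succ` / `klw_pairAmplitude_succ` (plain: first-order self-contraction term PRESENT).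

The bubbles of `𝒲 ⋆_{D_n} 𝒲 - 𝒲 ⋆_{D_{n+1}} 𝒲` carry line pairs from `D_n ⊗ D_n - D_{n+1} ⊗ D_{n+1} = g⊗g + g⊗D_{n+1} + D_{n+1}⊗g`
(`D_n = D_{n+1} + g`): the FULL rung of the step — same-slice plus slice-with-SOFTER-partner — read off the quartic Wick kernel
alone (FKT's `C⊗C + C⊗D + D⊗C` ladders; HOME/p1/E5-NOTE §3.4).  Everything here is exact algebra (no bounds, no limits); nothing
about the model is asserted beyond identities of its defined objects; nothing asserts superconductivity.

References: M. Salmhofer, Commun. Math. Phys. 194 (1998) 249, §3 (Wick-ordered continuous RG); J. Feldman, H. Knörrer,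
E. Trubowitz, *Fermionic Functional Integrals and the Renormalization Group* (2002) §I.4–I.5 (Wick ordering `Ω_C`), Rev. Math.
Phys. 15 (2003) 949 («Single scale analysis of many fermion systems», Part 2: overlapping loops); cell files HOME/p1/E5-NOTE.md,
E2-RUNG-WEIGHT-NOTE.md, E2-STRUCTURE-NOTE.md.
-/

noncomputable section

namespace Summit.HubbardSuperconductivity.HubbardSuperconductivity.Theorems.KLRegimeWick

set_option linter.dupNamespace false -- summit = problem name (single-conjunct summit), D-0017

open Real Finset Literature.MathematicalPhysics.QuantumLattice Literature.Probability.LatticeModels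
open Summit.HubbardSuperconductivity.HubbardSuperconductivity.Theorems.KLProgrammeLegKernels
open Summit.HubbardSuperconductivity.HubbardSuperconductivity.Theorems.KLRegimeSplit

/-! ## §2 (generic) Wick smearing and the RG step on a finite Grassmann algebra

Model-free algebra of `gaussConv` / `effAction` (generic over a commutative `ℚ`-algebra `R` and a finite label type `Γ`); kept in
this namespace as helpers of the engine stub (a Literature re-homing with print locators — Salmhofer 1998 §3, FKT 2002 §I.4 — is
the librarians' call). -/

section Generic

variable (R : Type*) [CommRing R] [Algebra ℚ R] {Γ : Type*} [Fintype Γ]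

/-- **The Wick star product** w.r.t. the covariance `C`: `a ⋆_C b = e^{Δ_C}((e^{-Δ_C} a)·(e^{-Δ_C} b))` — the product of the
two Wick-ordered elements `:a:_C = e^{-Δ_C} a`, `:b:_C` re-expanded in Wick-ordered form; by Wick's theorem for products of
Wick monomials it collects exactly the contractions BETWEEN `a` and `b`. -/
def wickStar (C : Matrix Γ Γ R) (a b : GrassmannAlgebra R Γ) : GrassmannAlgebra R Γ :=
  gaussConv R C (gaussConv R (-C) a * gaussConv R (-C) b)

/-- `e^{Δ_C} e^{-Δ_C} = 1`. -/
theorem gaussConv_mul_neg (C : Matrix Γ Γ R) : gaussConv R C * gaussConv R (-C) = 1 := by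
  have h := gaussConv_neg_mul R (-C)
  rwa [neg_neg] at h

/-- `e^{Δ_C}(e^{-Δ_C} a) = a`. -/
theorem gaussConv_gaussConv_neg_apply (C : Matrix Γ Γ R) (a : GrassmannAlgebra R Γ) :
    gaussConv R C (gaussConv R (-C) a) = a := by
  rw [← Module.End.mul_apply, gaussConv_mul_neg, Module.End.one_apply]

/-- `e^{-Δ_C}(e^{Δ_C} a) = a`. -/
theorem gaussConv_neg_gaussConv_apply (C : Matrix Γ Γ R) (a : GrassmannAlgebra R Γ) :
    gaussConv R (-C) (gaussConv R C a) = a := by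
  rw [← Module.End.mul_apply, gaussConv_neg_mul, Module.End.one_apply]

/-- `e^{-Δ_D}(e^{Δ_{D+C}} b) = e^{Δ_C} b`. -/
theorem gaussConv_neg_gaussConv_add_apply (C D : Matrix Γ Γ R) (b : GrassmannAlgebra R Γ) :
    gaussConv R (-D) (gaussConv R (D + C) b) = gaussConv R C b := by
  rw [gaussConv_add_apply, gaussConv_neg_gaussConv_apply]

/-- **The smeared action moves only by the NONLINEAR part of the step**: for covariances `C` (integrated) and `D` (kept),
`e^{Δ_D}(effAction C V) - e^{Δ_{D+C}} V = e^{Δ_D}(effAction C V - e^{Δ_C} V)` — the first cumulant `e^{Δ_C}V` of the step is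
absorbed EXACTLY by the change of smearing covariance `D + C ↦ D`; no single-vertex self-contraction survives. -/
theorem gaussConv_effAction_sub_gaussConv_add (C D : Matrix Γ Γ R) (V : GrassmannAlgebra R Γ) :
    gaussConv R D (effAction R C V) - gaussConv R (D + C) V = gaussConv R D (effAction R C V - gaussConv R C V) := by
  rw [map_sub, gaussConv_add_apply]

/-- **The second cumulant in Wick form**: with `W = e^{Δ_{D+C}} V` (so `V = e^{-Δ_{D+C}} W` and `e^{Δ_C} V = e^{-Δ_D} W`),
`e^{Δ_D}(e^{Δ_C}(V·V) - (e^{Δ_C}V)·(e^{Δ_C}V)) = W ⋆_{D+C} W - W ⋆_D W`. -/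
theorem gaussConv_secondCumulant_eq_wickStar_sub (C D : Matrix Γ Γ R) (V : GrassmannAlgebra R Γ) :
    gaussConv R D (gaussConv R C (V * V) - gaussConv R C V * gaussConv R C V) =
      wickStar R (D + C) (gaussConv R (D + C) V) (gaussConv R (D + C) V) -
        wickStar R D (gaussConv R (D + C) V) (gaussConv R (D + C) V) := by
  rw [wickStar, wickStar, gaussConv_neg_gaussConv_apply, gaussConv_neg_gaussConv_add_apply, map_sub,
    gaussConv_add_apply]

end Generic

/-! ## §1 The carriers of the Wick-ordered scheme -/

section Model

variable (L M : ℕ) [NeZero L] [NeZero M]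

/-- **The hard covariance at scale `n`**: `C^K_{>Λ_n}` (the fields already integrated in `𝒱_n`). -/
def klHardCov (β μ : ℝ) (K : TrigPolyC4v) (n : ℕ) : Matrix (HubbardFieldIdx L M) (HubbardFieldIdx L M) ℂ :=
  hubbardCovAboveCT L M β μ 0 K (klScale klE0 n)

/-- **The soft covariance at scale `n`**: `D_n = C^K_{≤Λ_n} = C^K - C^K_{>Λ_n}` (the fields NOT yet integrated in `𝒱_n`;
the Wick-ordering covariance of the scale-`n` action). -/
def klSoftCov (β μ : ℝ) (K : TrigPolyC4v) (n : ℕ) : Matrix (HubbardFieldIdx L M) (HubbardFieldIdx L M) ℂ :=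
  hubbardCovBelowCT L M β μ 0 K (klScale klE0 n)

/-- **The slice covariance of step `n`**: `g_n = C^K_{(Λ_n, Λ_{n-1}]} = C^K_{>Λ_n} - C^K_{>Λ_{n-1}}` (for `n = 0` it is `0`). -/
def klSliceCov (β μ : ℝ) (K : TrigPolyC4v) (n : ℕ) : Matrix (HubbardFieldIdx L M) (HubbardFieldIdx L M) ℂ :=
  hubbardCovSliceCT L M β μ 0 K (klScale klE0 n) (klScale klE0 (n - 1))

/-- The step-`n` partition function `Z_n = ∫ dμ_{g_n} e^{-𝒱_{n-1}}` in the form the tree's semigroup lemma wants: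
`hubbardEffPartitionFnCT` at scale `Λ_n` (nonvanishing = the step is defined; `IsUnit` form for `effAction_add`). -/
def klStepPartitionFn (β U μ : ℝ) (K : TrigPolyC4v) (n : ℕ) : ℂ :=
  hubbardEffPartitionFnCT L M β U μ 0 K (klScale klE0 n)

/-- **The Wick-smeared scale-`n` action** `𝒲_n = e^{Δ_{D_n}} 𝒱_n`: the scale-`n` effective action with all SOFT
self-contractions added — its kernels are the Wick-ordered kernels of `𝒱_n` w.r.t. the fields not yet integrated
(`𝒱_n = :𝒲_n:_{D_n} = e^{-Δ_{D_n}} 𝒲_n`, `klw_effectiveAction_eq_gaussConv_neg_wickAction`). -/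
def klWickAction (β U μ : ℝ) (K : TrigPolyC4v) (n : ℕ) : HubbardGrassmann L M :=
  gaussConv ℂ (klSoftCov L M β μ K n) (klEffectiveAction L M β U μ K klE0 n)

/-- **The Wick pair amplitude at scale `n`**: the quartic vertex function of `𝒲_n` at the pair labels of `klPairAmplitude`
(`(k↑, Q-k↓) → (k'↑, Q-k'↓)` at the lowest Matsubara frequencies). -/
def klWickPairAmplitude (β U μ : ℝ) (K : TrigPolyC4v) (n : ℕ) (Q k k' : TorusSite 2 L) : ℂ :=
  vertexFn L M β (klWickAction L M β U μ K n) 4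
    ![(((omega0 M, k'), 0), 0), ((((omega0 M).rev, Q - k'), 1), 0), ((((omega0 M).rev, Q - k), 1), 1),
      (((omega0 M, k), 0), 1)]

variable (β U μ : ℝ) (K : TrigPolyC4v)

omit [NeZero L] [NeZero M] in
/-- Lowering the scale by one adds a slice to the hard covariance: `C^K_{>Λ_{n+1}} = g_{n+1} + C^K_{>Λ_n}`. -/
theorem klw_hardCov_succ (n : ℕ) :
    klHardCov L M β μ K (n + 1) = klSliceCov L M β μ K (n + 1) + klHardCov L M β μ K n := by
  rw [klHardCov, klHardCov, klSliceCov, Nat.add_sub_cancel]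
  exact hubbardCovAboveCT_eq_slice_add L M β μ 0 K _ _

omit [NeZero L] [NeZero M] in
/-- … and removes it from the soft one: `D_n = D_{n+1} + g_{n+1}`. -/
theorem klw_softCov_eq_succ_add_slice (n : ℕ) :
    klSoftCov L M β μ K n = klSoftCov L M β μ K (n + 1) + klSliceCov L M β μ K (n + 1) := by
  rw [klSoftCov, klSoftCov, hubbardCovBelowCT, hubbardCovBelowCT, klSliceCov, Nat.add_sub_cancel, hubbardCovSliceCT]
  abel

omit [NeZero L] [NeZero M] in
/-- Hard plus soft is everything: `C^K_{>Λ_n} + D_n = C^K`. -/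
theorem klw_hardCov_add_softCov (n : ℕ) :
    klHardCov L M β μ K n + klSoftCov L M β μ K n = hubbardCovarianceCT L M β μ 0 K :=
  hubbardCovAboveCT_add_hubbardCovBelowCT L M β μ 0 K _

omit [NeZero M] in
/-- `𝒱_n = e^{-Δ_{D_n}} 𝒲_n`: the plain action is the Wick-ORDERED form of the smeared one. -/
theorem klw_effectiveAction_eq_gaussConv_neg_wickAction (n : ℕ) :
    klEffectiveAction L M β U μ K klE0 n = gaussConv ℂ (-klSoftCov L M β μ K n) (klWickAction L M β U μ K n) := by
  rw [klWickAction, gaussConv_neg_gaussConv_apply]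

/-! ## §3 The one-step identities of the model -/

omit [NeZero M] in
/-- **One-step semigroup for the carrier D1**: `𝒱_{n+1} = effAction g_{n+1} 𝒱_n`, provided the scale-`Λ_n` partition function
does not vanish (`hubbardEffectiveActionCT_semigroup`). -/
theorem klw_effectiveAction_succ (n : ℕ) (hZ : klStepPartitionFn L M β U μ K n ≠ 0) :
    klEffectiveAction L M β U μ K klE0 (n + 1) =
      effAction ℂ (klSliceCov L M β μ K (n + 1)) (klEffectiveAction L M β U μ K klE0 n) := by
  rw [klEffectiveAction, klEffectiveAction, klSliceCov, Nat.add_sub_cancel]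
  exact hubbardEffectiveActionCT_semigroup L M β U μ 0 K _ hZ

omit [NeZero M] in
/-- **`klw_wickAction_succ` — the Wick-smeared action moves only by the nonlinear part of the step**:
`𝒲_{n+1} - 𝒲_n = e^{Δ_{D_{n+1}}}(effAction g_{n+1} 𝒱_n - e^{Δ_{g_{n+1}}} 𝒱_n)`.  No first-order (single-vertex self-contraction)
term: the slice self-contractions of `W₆^{(n)}, W₈^{(n)}, …` that the PLAIN step carries (`klw_pairAmplitude_succ`) are exactly
absorbed by the change of the smearing covariance `D_n = D_{n+1} + g_{n+1}`. -/
theorem klw_wickAction_succ (n : ℕ) (hZ : klStepPartitionFn L M β U μ K n ≠ 0) :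
    klWickAction L M β U μ K (n + 1) - klWickAction L M β U μ K n =
      gaussConv ℂ (klSoftCov L M β μ K (n + 1))
        (effAction ℂ (klSliceCov L M β μ K (n + 1)) (klEffectiveAction L M β U μ K klE0 n) -
          gaussConv ℂ (klSliceCov L M β μ K (n + 1)) (klEffectiveAction L M β U μ K klE0 n)) := by
  rw [klWickAction, klWickAction, klw_effectiveAction_succ L M β U μ K n hZ, klw_softCov_eq_succ_add_slice L M β μ K n]
  exact gaussConv_effAction_sub_gaussConv_add ℂ _ _ _

omit [NeZero M] in
/-- **`klw_wickAction_succ_secondOrder` — the discrete Wick-ordered flow at second order.**  With `g = g_{n+1}`,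
`D = D_{n+1}` and the third-order remainder of the step
`R₃ = effAction g 𝒱_n - e^{Δ_g}𝒱_n + ½(e^{Δ_g}(𝒱_n·𝒱_n) - (e^{Δ_g}𝒱_n)·(e^{Δ_g}𝒱_n))`
(`GrassmannEffectiveActionTruncation.sum_norm_kernel_effAction_sub_secondOrder_le` bounds its kernels), EXACTLY
`𝒲_{n+1} = 𝒲_n - ½·(𝒲_n ⋆_{D_n} 𝒲_n - 𝒲_n ⋆_{D_{n+1}} 𝒲_n) + e^{Δ_{D_{n+1}}} R₃`:
the second-order change of the Wick kernels is a difference of Wick star products, whose line pairs come from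
`D_n⊗D_n - D_{n+1}⊗D_{n+1} = g⊗g + g⊗D_{n+1} + D_{n+1}⊗g` — the FULL rung (same slice + softer partner). -/
theorem klw_wickAction_succ_secondOrder (n : ℕ) (hZ : klStepPartitionFn L M β U μ K n ≠ 0) :
    klWickAction L M β U μ K (n + 1) =
      klWickAction L M β U μ K n -
        (2 : ℂ)⁻¹ • (wickStar ℂ (klSoftCov L M β μ K n) (klWickAction L M β U μ K n) (klWickAction L M β U μ K n) -
          wickStar ℂ (klSoftCov L M β μ K (n + 1)) (klWickAction L M β U μ K n) (klWickAction L M β U μ K n)) +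
        gaussConv ℂ (klSoftCov L M β μ K (n + 1))
          (effAction ℂ (klSliceCov L M β μ K (n + 1)) (klEffectiveAction L M β U μ K klE0 n) -
              gaussConv ℂ (klSliceCov L M β μ K (n + 1)) (klEffectiveAction L M β U μ K klE0 n) +
            (2 : ℂ)⁻¹ • (gaussConv ℂ (klSliceCov L M β μ K (n + 1))
                (klEffectiveAction L M β U μ K klE0 n * klEffectiveAction L M β U μ K klE0 n) -
              gaussConv ℂ (klSliceCov L M β μ K (n + 1)) (klEffectiveAction L M β U μ K klE0 n) *
                gaussConv ℂ (klSliceCov L M β μ K (n + 1)) (klEffectiveAction L M β U μ K klE0 n))) := by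
  have h1 := klw_wickAction_succ L M β U μ K n hZ
  have h2 := gaussConv_secondCumulant_eq_wickStar_sub ℂ (klSliceCov L M β μ K (n + 1)) (klSoftCov L M β μ K (n + 1))
    (klEffectiveAction L M β U μ K klE0 n)
  rw [← klw_softCov_eq_succ_add_slice L M β μ K n] at h2
  rw [← klWickAction] at h2
  rw [map_add, map_smul, h2]
  rw [sub_eq_iff_eq_add'] at h1
  rw [h1]
  abel

omit [NeZero L] [NeZero M] in
/-- Vertex functions are linear: subtraction. -/
theorem klw_vertexFn_sub (G G' : HubbardGrassmann L M) (m : ℕ) (X : Fin m → HubbardFieldIdx L M) :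
    vertexFn L M β (G - G') m X = vertexFn L M β G m X - vertexFn L M β G' m X := by
  rw [eq_sub_iff_add_eq, ← vertexFn_add, sub_add_cancel]

/-- **The Wick pair amplitude moves only by the nonlinear part of the step** (value reading of `klw_wickAction_succ`). -/
theorem klw_wickPairAmplitude_succ (n : ℕ) (hZ : klStepPartitionFn L M β U μ K n ≠ 0) (Q k k' : TorusSite 2 L) :
    klWickPairAmplitude L M β U μ K (n + 1) Q k k' - klWickPairAmplitude L M β U μ K n Q k k' =
      vertexFn L M β (gaussConv ℂ (klSoftCov L M β μ K (n + 1))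
        (effAction ℂ (klSliceCov L M β μ K (n + 1)) (klEffectiveAction L M β U μ K klE0 n) -
          gaussConv ℂ (klSliceCov L M β μ K (n + 1)) (klEffectiveAction L M β U μ K klE0 n))) 4
        ![(((omega0 M, k'), 0), 0), ((((omega0 M).rev, Q - k'), 1), 0), ((((omega0 M).rev, Q - k), 1), 1),
          (((omega0 M, k), 0), 1)] := by
  rw [klWickPairAmplitude, klWickPairAmplitude, ← klw_vertexFn_sub, klw_wickAction_succ L M β U μ K n hZ]

/-- **Contrast: the PLAIN pair amplitude carries the first-order self-contraction term.**
`𝒞_{n+1} - 𝒞_n = 𝒱₄[e^{Δ_g}𝒱_n - 𝒱_n] + 𝒱₄[effAction g 𝒱_n - e^{Δ_g}𝒱_n]` at the pair labels: the first bracket is the slice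
self-contraction of the higher plain kernels `W₆^{(n)}, W₈^{(n)}, …` of `𝒱_n` (the rungs with a HARDER partner live here), the
second the nonlinear part. -/
theorem klw_pairAmplitude_succ (n : ℕ) (hZ : klStepPartitionFn L M β U μ K n ≠ 0) (Q k k' : TorusSite 2 L) :
    klPairAmplitude L M β U μ K (n + 1) Q k k' - klPairAmplitude L M β U μ K n Q k k' =
      vertexFn L M β (gaussConv ℂ (klSliceCov L M β μ K (n + 1)) (klEffectiveAction L M β U μ K klE0 n) -
          klEffectiveAction L M β U μ K klE0 n) 4
        ![(((omega0 M, k'), 0), 0), ((((omega0 M).rev, Q - k'), 1), 0), ((((omega0 M).rev, Q - k), 1), 1),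
          (((omega0 M, k), 0), 1)] +
      vertexFn L M β (effAction ℂ (klSliceCov L M β μ K (n + 1)) (klEffectiveAction L M β U μ K klE0 n) -
          gaussConv ℂ (klSliceCov L M β μ K (n + 1)) (klEffectiveAction L M β U μ K klE0 n)) 4
        ![(((omega0 M, k'), 0), 0), ((((omega0 M).rev, Q - k'), 1), 0), ((((omega0 M).rev, Q - k), 1), 1),
          (((omega0 M, k), 0), 1)] := by
  rw [klPairAmplitude, klPairAmplitude, ← klw_vertexFn_sub, ← vertexFn_add, klw_effectiveAction_succ L M β U μ K n hZ]
  congr 1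
  abel

/-- At the pair labels the Wick and the plain amplitude differ by the soft self-contractions of `𝒱_n`:
`𝒞^W_n - 𝒞_n = 𝒱₄[e^{Δ_{D_n}}𝒱_n - 𝒱_n]`. -/
theorem klw_wickPairAmplitude_sub_pairAmplitude (n : ℕ) (Q k k' : TorusSite 2 L) :
    klWickPairAmplitude L M β U μ K n Q k k' - klPairAmplitude L M β U μ K n Q k k' =
      vertexFn L M β (gaussConv ℂ (klSoftCov L M β μ K n) (klEffectiveAction L M β U μ K klE0 n) -
          klEffectiveAction L M β U μ K klE0 n) 4
        ![(((omega0 M, k'), 0), 0), ((((omega0 M).rev, Q - k'), 1), 0), ((((omega0 M).rev, Q - k), 1), 1),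
          (((omega0 M, k), 0), 1)] := by
  rw [klWickPairAmplitude, klPairAmplitude, ← klw_vertexFn_sub, klWickAction]

end Model

end Summit.HubbardSuperconductivity.HubbardSuperconductivity.Theorems.KLRegimeWick

end
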